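import Summits.Ventures.Crystal3D.Theorems.StickyWulffConstantGenericWallFloorFramePropagation
import HarnessLib

/-!
# Frame propagation at hcp-type junctions: the frame class `{Λ₀, Λ₀⁻}` is transported
# (crux `GenericWallFloor`, line `WallLedgerG`)

HONEST FRAMING. Part of the venture `Summits/Ventures/Crystal3D` (cell `crystal3d-full`), helper
`--supports` the crux `GenericWallFloor` (stmt-Ventures-19480) of `route-Ventures-StickyWulffConstant`,
registered line `WallLedgerG` (planner cf-p1 gen 16), stub `stub_twoSlabAdhesion : TwoSlabAdhesion`.
Sequel of `…GenericWallFloorFramePropagation`: there an hcp-type junction between two Barlow patches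
(shared ball with its twelve neighbours, transition `q ↦ y₂ + M(q − y₁)`) was shown to keep the
stacking type and to send in-layer vectors to horizontal vectors.  Here the conclusion is completed to
the FRAME CLASS: `M·Λ₀ = B(c)` and `M·Λ₀⁻ = B(−c)` for a sign `c` (`Λ₀ = B(1) = fccStacking 1 √(2/3)`,
`Λ₀⁻ = B(−1)` its `e₃`-mirror twin), i.e. `M` permutes `{Λ₀, Λ₀⁻}`
(`frame_hcpType_of_shell_transfer`).  With `frame_fccType_of_shell_transfer` this is the complete
LOCAL toolkit for propagating Barlow frames along chains of overlapping patches: across fcc-type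
junctions the local fcc lattice is transported, across hcp-type junctions the pair `{L·Λ₀, L·Λ₀⁻}` —
so a chain that meets faulted regions of ONE axis class only ends in a frame `L` with
`A₂·Λ₀ ∈ {L·Λ₀, L·Λ₀⁻}` and `A₁·Λ₀ ∈ {L·Λ₀, L·Λ₀⁻}`: co-axial (`coaxial_of_common_frame`).

WHAT THIS IS NOT: the global chain argument and its areal version; rung F-C1 not moved.
-/

noncomputable section

namespace Summit.Ventures.Crystal3D.Theorems

open Literature.MathematicalPhysics.StatisticalMechanics
open Literature.Barriers.AtomisticToContinuum (haggLabel_eq_mul_of_const barlowAddSubgroupOfConst)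
open scoped InnerProductSpace

/-! ### In-layer bookkeeping -/
/-- Adding an in-layer vector `site(0, I, J)` (of any stacking `s'`) moves a site within its layer. -/
theorem barlowPos_add_inLayer (H : ℝ) (σ s' : ℤ → ℤ) (k i j I J : ℤ) :
    barlowPos 1 H σ k i j + barlowPos 1 H s' 0 I J = barlowPos 1 H σ k (i + I) (j + J) := by
  simp only [barlowPos, haggLabel_zero]; push_cast; module

/-- The in-layer vectors `site(0,I,J)` in coordinates: `(I + J/2, (√3/2) J, 0)`. -/
theorem barlowPos_inLayer_apply (H : ℝ) (s' : ℤ → ℤ) (I J : ℤ) :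
    barlowPos 1 H s' 0 I J 0 = I + (J : ℝ) / 2 ∧ barlowPos 1 H s' 0 I J 1 = Real.sqrt 3 / 2 * J ∧
      barlowPos 1 H s' 0 I J 2 = 0 := by
  simp only [barlowPos_apply_zero, barlowPos_apply_one, barlowPos_apply_two, haggLabel_zero]
  push_cast
  refine ⟨by ring, by ring, by ring⟩

/-- **A horizontal unit neighbour of a site is an in-layer site.**  If `y + a ∈ B(σ)` with
`‖a‖ = 1` and `a 2 = 0`, `y = site(k,i,j)`, then `a = site(0, I, J)` with `(−I, −J) ∈ sixOffsets`. -/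
theorem exists_inLayer_of_horizontal {σ : ℤ → ℤ} (hσ : IsHaggSeq σ) (k i j : ℤ)
    {a : EuclideanSpace ℝ (Fin 3)} (ha1 : ‖a‖ = 1) (ha2 : a 2 = 0)
    (ha : barlowPos 1 (Real.sqrt (2 / 3)) σ k i j + a ∈ barlowStacking 1 (Real.sqrt (2 / 3)) σ) :
    ∃ I J : ℤ, a = barlowPos 1 (Real.sqrt (2 / 3)) constHagg 0 I J ∧ (-I, -J) ∈ sixOffsets := by
  obtain ⟨k', i', j', e⟩ := ha
  have hH : (0 : ℝ) < Real.sqrt (2 / 3) := Real.sqrt_pos.2 (by norm_num)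
  have hd : dist (barlowPos 1 (Real.sqrt (2 / 3)) σ k i j) (barlowPos 1 (Real.sqrt (2 / 3)) σ k' i' j') = 1 := by
    rw [← e, dist_self_add_right, ha1]
  have e2 := congrArg (fun q : EuclideanSpace ℝ (Fin 3) => q 2) e
  simp only [PiLp.add_apply, barlowPos_apply_two, ha2, add_zero] at e2
  have hk : ((k : ℤ) : ℝ) = k' := by
    have : ((k : ℝ) - k') * Real.sqrt (2 / 3) = 0 := by nlinarith [e2]
    have := (mul_eq_zero.1 this).resolve_right hH.ne'
    linarith
  have hkZ : k' = k := by exact_mod_cast hk.symm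
  subst hkZ
  rw [dist_barlowPos_eq_iff hσ one_pos sqrt_twoThirds_sq] at hd
  rcases hd with ⟨-, hm⟩ | ⟨h, -⟩ | ⟨h, -⟩
  · refine ⟨i' - i, j' - j, ?_, ?_⟩
    · have := barlowPos_add_inLayer (Real.sqrt (2 / 3)) σ constHagg k' i j (i' - i) (j' - j)
      rw [add_sub_cancel, add_sub_cancel, ← e] at this
      exact (add_left_cancel this).symm
    · simpa using hm
  · omega
  · omega

/-- Inner product of two in-layer vectors in integer form:
`⟪site(0,I,J), site(0,I',J')⟫ = I I' + (I J' + J I')/2 + J J'`. -/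
theorem inner_inLayer (H : ℝ) (I J I' J' : ℤ) :
    ⟪barlowPos 1 H constHagg 0 I J, barlowPos 1 H constHagg 0 I' J'⟫_ℝ =
      (I : ℝ) * I' + ((I : ℝ) * J' + (J : ℝ) * I') / 2 + (J : ℝ) * J' := by
  obtain ⟨a0, a1, a2⟩ := barlowPos_inLayer_apply H constHagg I J
  obtain ⟨b0, b1, b2⟩ := barlowPos_inLayer_apply H constHagg I' J'
  have h3 : Real.sqrt 3 ^ 2 = 3 := Real.sq_sqrt (by norm_num)
  have hinner : ∀ x y : EuclideanSpace ℝ (Fin 3), ⟪x, y⟫_ℝ = x 0 * y 0 + x 1 * y 1 + x 2 * y 2 :=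
    fun x y => by simp [PiLp.inner_apply, Fin.sum_univ_three, mul_comm]
  rw [hinner, a0, a1, a2, b0, b1, b2]
  linear_combination ((J : ℝ) * J' / 4) * h3

/-- **The finite bookkeeping of adjacent hexagon pairs.**  For two in-layer unit vectors
`a = site(0,Ia,Ja)`, `b = site(0,Ib,Jb)` (`(−I,−J) ∈ sixOffsets`) with `⟪a,b⟫ = ½`
(`2IaIb + IaJb + JaIb + 2JaJb = 1`): they are not parallel (`IaJb ≠ JaIb`) and `(a+b)/3` is a hole
vector `± w` modulo the layer lattice: `3 ∣ Ia+Ib−ε`, `3 ∣ Ja+Jb−ε` for `ε = 1` or `ε = −1`. -/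
theorem hexagonPair_decide : ∀ p ∈ sixOffsets, ∀ q ∈ sixOffsets,
    2 * p.1 * q.1 + p.1 * q.2 + p.2 * q.1 + 2 * p.2 * q.2 = 1 →
    p.1 * q.2 ≠ p.2 * q.1 ∧
      ((3 ∣ -p.1 + -q.1 - 1 ∧ 3 ∣ -p.2 + -q.2 - 1) ∨ (3 ∣ -p.1 + -q.1 + 1 ∧ 3 ∣ -p.2 + -q.2 + 1)) := by
  decide

/-- **A vector orthogonal to two non-parallel horizontal vectors is vertical.** -/
theorem vertical_of_orthogonal (n a b : EuclideanSpace ℝ (Fin 3)) (ha : a 2 = 0) (hb : b 2 = 0)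
    (hna : ⟪n, a⟫_ℝ = 0) (hnb : ⟪n, b⟫_ℝ = 0) (hab : a 0 * b 1 - a 1 * b 0 ≠ 0) :
    n 0 = 0 ∧ n 1 = 0 := by
  have hinner : ∀ x y : EuclideanSpace ℝ (Fin 3), ⟪x, y⟫_ℝ = x 0 * y 0 + x 1 * y 1 + x 2 * y 2 :=
    fun x y => by simp [PiLp.inner_apply, Fin.sum_univ_three, mul_comm]
  rw [hinner, ha, mul_zero, add_zero] at hna
  rw [hinner, hb, mul_zero, add_zero] at hnb
  have h0 : n 0 * (a 0 * b 1 - a 1 * b 0) = 0 := by linear_combination b 1 * hna - a 1 * hnb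
  have h1 : n 1 * (a 0 * b 1 - a 1 * b 0) = 0 := by linear_combination a 0 * hnb - b 0 * hna
  exact ⟨(mul_eq_zero.1 h0).resolve_right hab, (mul_eq_zero.1 h1).resolve_right hab⟩

/-- Equality in `ℝ³` from the three coordinates. -/
theorem eq_of_apply_fin3 {x y : EuclideanSpace ℝ (Fin 3)} (h0 : x 0 = y 0) (h1 : x 1 = y 1)
    (h2 : x 2 = y 2) : x = y := by
  ext l; fin_cases l; exacts [h0, h1, h2]

/-- The squared norm of `ℝ³` in coordinates. -/
theorem norm_sq_eq_fin3 (x : EuclideanSpace ℝ (Fin 3)) : ‖x‖ ^ 2 = x 0 ^ 2 + x 1 ^ 2 + x 2 ^ 2 := by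
  rw [EuclideanSpace.real_norm_sq_eq, Fin.sum_univ_three]

/-- In-layer sites do not depend on the Hägg word. -/
theorem barlowPos_inLayer_eq (H : ℝ) (s s' : ℤ → ℤ) (I J : ℤ) :
    barlowPos 1 H s 0 I J = barlowPos 1 H s' 0 I J := by simp only [barlowPos, haggLabel_zero]

/-- Negating an in-layer site vector. -/
theorem neg_barlowPos_inLayer (H : ℝ) (s : ℤ → ℤ) (I J : ℤ) :
    -barlowPos 1 H s 0 I J = barlowPos 1 H s 0 (-I) (-J) := by
  simp only [barlowPos, haggLabel_zero]; push_cast; module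

/-! ### A constant stacking is captured by the images of its three generators -/
/-- **Generator capture.**  `c₁, c₂ = ±1`.  If a linear isometry `M` maps the three generators
`site(0,1,0)`, `site(0,0,1)`, `site(1,0,0)` of `B(c₁)` into `B(c₂)`, then `M·B(c₁) = B(c₂)`
(inclusion by generation; equality by counting the two twelve-point unit shells). -/
theorem image_const_eq_of_generators {c₁ c₂ : ℤ} (hc₁ : c₁ = 1 ∨ c₁ = -1) (hc₂ : c₂ = 1 ∨ c₂ = -1)
    (M : EuclideanSpace ℝ (Fin 3) ≃ₗᵢ[ℝ] EuclideanSpace ℝ (Fin 3))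
    (hu : M (barlowPos 1 (Real.sqrt (2 / 3)) (fun _ : ℤ => c₁) 0 1 0) ∈
      barlowStacking 1 (Real.sqrt (2 / 3)) (fun _ : ℤ => c₂))
    (hv : M (barlowPos 1 (Real.sqrt (2 / 3)) (fun _ : ℤ => c₁) 0 0 1) ∈
      barlowStacking 1 (Real.sqrt (2 / 3)) (fun _ : ℤ => c₂))
    (hf : M (barlowPos 1 (Real.sqrt (2 / 3)) (fun _ : ℤ => c₁) 1 0 0) ∈
      barlowStacking 1 (Real.sqrt (2 / 3)) (fun _ : ℤ => c₂)) :
    M '' barlowStacking 1 (Real.sqrt (2 / 3)) (fun _ : ℤ => c₁) =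
      barlowStacking 1 (Real.sqrt (2 / 3)) (fun _ : ℤ => c₂) := by
  classical
  have hH₁ : IsHaggSeq (fun _ : ℤ => c₁) := fun _ => hc₁
  have hH₂ : IsHaggSeq (fun _ : ℤ => c₂) := fun _ => hc₂
  set G₁ : AddSubgroup (EuclideanSpace ℝ (Fin 3)) :=
    barlowAddSubgroupOfConst 1 (Real.sqrt (2 / 3)) (fun _ : ℤ => c₁) (fun _ => rfl) with hG₁
  have hG₁mem : ∀ w, w ∈ G₁ ↔ w ∈ barlowStacking 1 (Real.sqrt (2 / 3)) (fun _ : ℤ => c₁) :=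
    fun w => Iff.rfl
  set G₂ : AddSubgroup (EuclideanSpace ℝ (Fin 3)) :=
    barlowAddSubgroupOfConst 1 (Real.sqrt (2 / 3)) (fun _ : ℤ => c₂) (fun _ => rfl) with hG₂
  have hG₂mem : ∀ w, w ∈ G₂ ↔ w ∈ barlowStacking 1 (Real.sqrt (2 / 3)) (fun _ : ℤ => c₂) :=
    fun w => Iff.rfl
  have hsub : M '' barlowStacking 1 (Real.sqrt (2 / 3)) (fun _ : ℤ => c₁) ⊆
      barlowStacking 1 (Real.sqrt (2 / 3)) (fun _ : ℤ => c₂) := by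
    rintro _ ⟨p, ⟨K, I, J, rfl⟩, rfl⟩
    rw [barlowPos_constε_eq_combo _ c₁ K I J, map_add, map_add, map_smul, map_smul, map_smul,
      Int.cast_smul_eq_zsmul, Int.cast_smul_eq_zsmul, Int.cast_smul_eq_zsmul]
    exact (hG₂mem _).1 (G₂.add_mem (G₂.add_mem (G₂.zsmul_mem ((hG₂mem _).2 hu) I)
      (G₂.zsmul_mem ((hG₂mem _).2 hv) J)) (G₂.zsmul_mem ((hG₂mem _).2 hf) K))
  refine hsub.antisymm ?_
  -- the unit shells
  set S₁ : Set (EuclideanSpace ℝ (Fin 3)) :=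
    {w | w ∈ barlowStacking 1 (Real.sqrt (2 / 3)) (fun _ : ℤ => c₁) ∧ ‖w‖ = 1} with hS₁
  set S₂ : Set (EuclideanSpace ℝ (Fin 3)) :=
    {w | w ∈ barlowStacking 1 (Real.sqrt (2 / 3)) (fun _ : ℤ => c₂) ∧ ‖w‖ = 1} with hS₂
  have hcard : ∀ {c : ℤ}, IsHaggSeq (fun _ : ℤ => c) →
      ({w | w ∈ barlowStacking 1 (Real.sqrt (2 / 3)) (fun _ : ℤ => c) ∧ ‖w‖ = 1} :
        Set (EuclideanSpace ℝ (Fin 3))).ncard = 12 := by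
    intro c hc
    have h0 : (0 : EuclideanSpace ℝ (Fin 3)) ∈ barlowStacking 1 (Real.sqrt (2 / 3)) (fun _ : ℤ => c) :=
      ⟨0, 0, 0, (barlowPos_zero _ _).symm⟩
    have h12 := ncard_touching_eq_twelve hc one_pos sqrt_twoThirds_sq h0
    have hset : ({w | w ∈ barlowStacking 1 (Real.sqrt (2 / 3)) (fun _ : ℤ => c) ∧ ‖w‖ = 1} :
        Set (EuclideanSpace ℝ (Fin 3))) =
        {w | w ∈ barlowStacking 1 (Real.sqrt (2 / 3)) (fun _ : ℤ => c) ∧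
          dist (0 : EuclideanSpace ℝ (Fin 3)) w = 1} := by
      ext w
      simp only [Set.mem_setOf_eq, dist_comm (0 : EuclideanSpace ℝ (Fin 3)), dist_zero_right]
    rw [hset]; exact h12
  have hS₁card : S₁.ncard = 12 := hcard hH₁
  have hS₂card : S₂.ncard = 12 := hcard hH₂
  have hS₂fin : S₂.Finite := Set.finite_of_ncard_ne_zero (by rw [hS₂card]; norm_num)
  have hIS : M '' S₁ ⊆ S₂ := by
    rintro _ ⟨w, ⟨hw, hw1⟩, rfl⟩
    exact ⟨hsub ⟨w, hw, rfl⟩, by rw [LinearIsometryEquiv.norm_map, hw1]⟩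
  have hIeq : M '' S₁ = S₂ :=
    Set.eq_of_subset_of_ncard_le hIS
      (by rw [hS₂card, Set.ncard_image_of_injective _ M.injective, hS₁card]) hS₂fin
  obtain ⟨nu, nv, nf⟩ := norm_barlowPos_generators hH₂
  have pre : ∀ g ∈ S₂, ∃ a ∈ barlowStacking 1 (Real.sqrt (2 / 3)) (fun _ : ℤ => c₁), M a = g := by
    intro g hg
    rw [← hIeq] at hg
    obtain ⟨a, ⟨ha, -⟩, rfl⟩ := hg
    exact ⟨a, ha, rfl⟩
  obtain ⟨a, ha, hMa⟩ := pre _ ⟨⟨0, 1, 0, rfl⟩, nu⟩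
  obtain ⟨b, hb, hMb⟩ := pre _ ⟨⟨0, 0, 1, rfl⟩, nv⟩
  obtain ⟨c, hc, hMc⟩ := pre _ ⟨⟨1, 0, 0, rfl⟩, nf⟩
  rintro q ⟨K, I, J, rfl⟩
  refine ⟨(I : ℝ) • a + (J : ℝ) • b + (K : ℝ) • c, ?_, ?_⟩
  · rw [Int.cast_smul_eq_zsmul, Int.cast_smul_eq_zsmul, Int.cast_smul_eq_zsmul]
    exact (hG₁mem _).1 (G₁.add_mem (G₁.add_mem (G₁.zsmul_mem ((hG₁mem _).2 ha) I)
      (G₁.zsmul_mem ((hG₁mem _).2 hb) J)) (G₁.zsmul_mem ((hG₁mem _).2 hc) K))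
  · rw [map_add, map_add, map_smul, map_smul, map_smul, hMa, hMb, hMc]
    exact (barlowPos_constε_eq_combo _ c₂ K I J).symm

/-! ### The frame class at an hcp-type junction -/

/-- The vertical generator part: `site(1,0,0) − (site(0,1,0) + site(0,0,1))/3 = H e₃` for
`Λ₀ = B(1)`, and `site(1,0,0)` of `B(−1)` is `H e₃ − (site(0,1,0) + site(0,0,1))/3`;
in coordinates. -/
theorem vertical_generator_apply :
    let g : EuclideanSpace ℝ (Fin 3) := barlowPos 1 (Real.sqrt (2 / 3)) constHagg 1 0 0 -
      (1 / 3 : ℝ) • (barlowPos 1 (Real.sqrt (2 / 3)) constHagg 0 1 0 +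
        barlowPos 1 (Real.sqrt (2 / 3)) constHagg 0 0 1)
    g 0 = 0 ∧ g 1 = 0 ∧ g 2 = Real.sqrt (2 / 3) ∧
      barlowPos 1 (Real.sqrt (2 / 3)) (fun _ : ℤ => (-1 : ℤ)) 1 0 0 =
        g - (1 / 3 : ℝ) • (barlowPos 1 (Real.sqrt (2 / 3)) constHagg 0 1 0 +
          barlowPos 1 (Real.sqrt (2 / 3)) constHagg 0 0 1) := by
  refine ⟨?_, ?_, ?_, ?_⟩
  · simp only [PiLp.sub_apply, PiLp.smul_apply, PiLp.add_apply, smul_eq_mul, barlowPos_apply_zero,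
      haggLabel_const, haggLabel_zero]
    push_cast; ring
  · simp only [PiLp.sub_apply, PiLp.smul_apply, PiLp.add_apply, smul_eq_mul, barlowPos_apply_one,
      haggLabel_const, haggLabel_zero]
    push_cast; ring
  · simp only [PiLp.sub_apply, PiLp.smul_apply, PiLp.add_apply, smul_eq_mul, barlowPos_apply_two]
    push_cast; ring
  · have hw : barlowOffset (1 : ℝ) = (1 / 3 : ℝ) • (triangularVec₁ 1 + triangularVec₂ 1) := by
      rw [← three_smul_barlowOffset, smul_smul]; norm_num
    simp only [barlowPos, hw, haggLabel_const, haggLabel_zero, haggLabel_constε]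
    push_cast
    module

/-- **hcp-type junction: the frame class `{Λ₀, Λ₀⁻}` is transported.**  If the ball shared by two
Barlow patches has an hcp-type site `(k₁,i₁,j₁)` in `B(σ₁)` (`σ₁(k₁−1) ≠ σ₁ k₁`) and the
transition `q ↦ y₂ + M(q − y₁)` carries its `B(σ₁)`-shell into `B(σ₂)`, then for a sign `c`:
`M·Λ₀ = B(c)` and `M·Λ₀⁻ = B(−c)` — `M` maps the pair `{Λ₀, Λ₀⁻}` onto itself. -/
theorem frame_hcpType_of_shell_transfer {σ₁ σ₂ : ℤ → ℤ} (hσ₁ : IsHaggSeq σ₁) (hσ₂ : IsHaggSeq σ₂)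
    (M : EuclideanSpace ℝ (Fin 3) ≃ₗᵢ[ℝ] EuclideanSpace ℝ (Fin 3)) (k₁ i₁ j₁ k₂ i₂ j₂ : ℤ)
    (hhcp : σ₁ (k₁ - 1) ≠ σ₁ k₁)
    (htr : ∀ q ∈ barlowStacking 1 (Real.sqrt (2 / 3)) σ₁,
      dist (barlowPos 1 (Real.sqrt (2 / 3)) σ₁ k₁ i₁ j₁) q = 1 →
      barlowPos 1 (Real.sqrt (2 / 3)) σ₂ k₂ i₂ j₂ + M (q - barlowPos 1 (Real.sqrt (2 / 3)) σ₁ k₁ i₁ j₁) ∈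
        barlowStacking 1 (Real.sqrt (2 / 3)) σ₂) :
    ∃ c : ℤ, (c = 1 ∨ c = -1) ∧
      M '' fccStacking 1 (Real.sqrt (2 / 3)) = barlowStacking 1 (Real.sqrt (2 / 3)) (fun _ : ℤ => c) ∧
      M '' barlowStacking 1 (Real.sqrt (2 / 3)) (fun _ : ℤ => (-1 : ℤ)) =
        barlowStacking 1 (Real.sqrt (2 / 3)) (fun _ : ℤ => -c) := by
  obtain ⟨-, hhor⟩ := hcpType_of_shell_transfer hσ₁ hσ₂ M k₁ i₁ j₁ k₂ i₂ j₂ hhcp htr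
  obtain ⟨nu, nv, -⟩ := norm_barlowPos_generators isHaggSeq_const
  obtain ⟨hg0, hg1, hg2, hfneg⟩ := vertical_generator_apply
  have h3 : (0 : ℝ) < Real.sqrt 3 := Real.sqrt_pos.2 (by norm_num)
  set y₁ := barlowPos 1 (Real.sqrt (2 / 3)) σ₁ k₁ i₁ j₁ with hy₁
  set y₂ := barlowPos 1 (Real.sqrt (2 / 3)) σ₂ k₂ i₂ j₂ with hy₂
  set u₀ : EuclideanSpace ℝ (Fin 3) := barlowPos 1 (Real.sqrt (2 / 3)) constHagg 0 1 0 with hu₀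
  set v₀ : EuclideanSpace ℝ (Fin 3) := barlowPos 1 (Real.sqrt (2 / 3)) constHagg 0 0 1 with hv₀
  set f₀ : EuclideanSpace ℝ (Fin 3) := barlowPos 1 (Real.sqrt (2 / 3)) constHagg 1 0 0 with hf₀
  set g : EuclideanSpace ℝ (Fin 3) := f₀ - (1 / 3 : ℝ) • (u₀ + v₀) with hg
  clear_value g f₀ u₀ v₀ y₁ y₂
  -- the in-layer generators and their (horizontal, in-layer) images
  have memu : y₁ + u₀ ∈ barlowStacking 1 (Real.sqrt (2 / 3)) σ₁ := by
    rw [hy₁, hu₀, barlowPos_add_inLayer]; exact ⟨_, _, _, rfl⟩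
  have memu' : y₁ - u₀ ∈ barlowStacking 1 (Real.sqrt (2 / 3)) σ₁ := by
    rw [sub_eq_add_neg, hy₁, hu₀, neg_barlowPos_inLayer, barlowPos_add_inLayer]; exact ⟨_, _, _, rfl⟩
  have memv : y₁ + v₀ ∈ barlowStacking 1 (Real.sqrt (2 / 3)) σ₁ := by
    rw [hy₁, hv₀, barlowPos_add_inLayer]; exact ⟨_, _, _, rfl⟩
  have memv' : y₁ - v₀ ∈ barlowStacking 1 (Real.sqrt (2 / 3)) σ₁ := by
    rw [sub_eq_add_neg, hy₁, hv₀, neg_barlowPos_inLayer, barlowPos_add_inLayer]; exact ⟨_, _, _, rfl⟩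
  have ha2 : (M u₀) 2 = 0 := hhor u₀ nu memu memu'
  have hb2 : (M v₀) 2 = 0 := hhor v₀ nv memv memv'
  have haB : y₂ + M u₀ ∈ barlowStacking 1 (Real.sqrt (2 / 3)) σ₂ := by
    have := htr _ memu (by rw [dist_self_add_right, nu]); rwa [add_sub_cancel_left] at this
  have hbB : y₂ + M v₀ ∈ barlowStacking 1 (Real.sqrt (2 / 3)) σ₂ := by
    have := htr _ memv (by rw [dist_self_add_right, nv]); rwa [add_sub_cancel_left] at this
  rw [hy₂] at haB hbB
  obtain ⟨Ia, Ja, ha, hpa⟩ := exists_inLayer_of_horizontal hσ₂ k₂ i₂ j₂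
    (by rw [LinearIsometryEquiv.norm_map, nu]) ha2 haB
  obtain ⟨Ib, Jb, hb, hpb⟩ := exists_inLayer_of_horizontal hσ₂ k₂ i₂ j₂
    (by rw [LinearIsometryEquiv.norm_map, nv]) hb2 hbB
  -- the angle between them: `⟪a, b⟫ = ⟪u₀, v₀⟫ = 1/2`
  have hinner : (2 : ℤ) * (-Ia) * (-Ib) + (-Ia) * (-Jb) + (-Ja) * (-Ib) + 2 * (-Ja) * (-Jb) = 1 := by
    have e1 : ⟪M u₀, M v₀⟫_ℝ = 1 / 2 := by
      rw [LinearIsometryEquiv.inner_map_map, hu₀, hv₀, inner_inLayer]; push_cast; ring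
    rw [ha, hb, inner_inLayer] at e1
    have : (2 : ℝ) * Ia * Ib + Ia * Jb + Ja * Ib + 2 * Ja * Jb = 1 := by linarith
    have hZ : (2 : ℤ) * Ia * Ib + Ia * Jb + Ja * Ib + 2 * Ja * Jb = 1 := by exact_mod_cast this
    linarith [hZ]
  obtain ⟨hnpar, hdiv⟩ := hexagonPair_decide _ hpa _ hpb hinner
  simp only [neg_neg, neg_mul_neg] at hnpar hdiv
  -- `M g` is vertical of length `H`
  obtain ⟨a0, a1, -⟩ := barlowPos_inLayer_apply (Real.sqrt (2 / 3)) constHagg Ia Ja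
  obtain ⟨b0, b1, -⟩ := barlowPos_inLayer_apply (Real.sqrt (2 / 3)) constHagg Ib Jb
  have hMg0 : (M g) 0 = 0 ∧ (M g) 1 = 0 := by
    refine vertical_of_orthogonal (M g) (M u₀) (M v₀) ha2 hb2 ?_ ?_ ?_
    · rw [LinearIsometryEquiv.inner_map_map]
      have : ⟪g, u₀⟫_ℝ = g 0 * u₀ 0 + g 1 * u₀ 1 + g 2 * u₀ 2 := by
        simp [PiLp.inner_apply, Fin.sum_univ_three, mul_comm]
      rw [this, hg0, hg1, hu₀, (barlowPos_inLayer_apply _ constHagg 1 0).2.2]; ring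
    · rw [LinearIsometryEquiv.inner_map_map]
      have : ⟪g, v₀⟫_ℝ = g 0 * v₀ 0 + g 1 * v₀ 1 + g 2 * v₀ 2 := by
        simp [PiLp.inner_apply, Fin.sum_univ_three, mul_comm]
      rw [this, hg0, hg1, hv₀, (barlowPos_inLayer_apply _ constHagg 0 1).2.2]; ring
    · rw [ha, hb, a0, a1, b0, b1]
      have hne : ((Ia * Jb : ℤ) : ℝ) ≠ ((Ja * Ib : ℤ) : ℝ) := by exact_mod_cast hnpar
      push_cast at hne
      intro h0
      apply hne
      have : Real.sqrt 3 * ((Ia : ℝ) * Jb - Ja * Ib) = 0 := by nlinarith [h0]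
      have := (mul_eq_zero.1 this).resolve_left h3.ne'
      linarith
  have hMg2 : (M g) 2 = Real.sqrt (2 / 3) ∨ (M g) 2 = -Real.sqrt (2 / 3) := by
    have hn : ‖M g‖ ^ 2 = Real.sqrt (2 / 3) ^ 2 := by
      rw [LinearIsometryEquiv.norm_map, norm_sq_eq_fin3, hg0, hg1, hg2]; ring
    rw [norm_sq_eq_fin3, hMg0.1, hMg0.2] at hn
    have : ((M g) 2 - Real.sqrt (2 / 3)) * ((M g) 2 + Real.sqrt (2 / 3)) = 0 := by nlinarith [hn]
    rcases mul_eq_zero.1 this with h | h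
    exacts [Or.inl (sub_eq_zero.1 h), Or.inr (eq_neg_of_add_eq_zero_left h)]
  -- the sign `t` of `M g` and the hole sign `ε` of `(a+b)/3`
  obtain ⟨t, ht, hMgt⟩ : ∃ t : ℤ, (t = 1 ∨ t = -1) ∧ (M g) 2 = (t : ℝ) * Real.sqrt (2 / 3) := by
    rcases hMg2 with h | h
    exacts [⟨1, Or.inl rfl, by rw [h, Int.cast_one, one_mul]⟩,
      ⟨-1, Or.inr rfl, by rw [h, Int.cast_neg, Int.cast_one, neg_one_mul]⟩]
  obtain ⟨ε, hε, I', J', hI', hJ'⟩ : ∃ ε : ℤ, (ε = 1 ∨ ε = -1) ∧ ∃ I' J' : ℤ,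
      Ia + Ib - ε = 3 * I' ∧ Ja + Jb - ε = 3 * J' := by
    rcases hdiv with ⟨⟨I', hI'⟩, ⟨J', hJ'⟩⟩ | ⟨⟨I', hI'⟩, ⟨J', hJ'⟩⟩
    exacts [⟨1, Or.inl rfl, I', J', hI', hJ'⟩, ⟨-1, Or.inr rfl, I', J', by rw [sub_neg_eq_add]; exact hI',
      by rw [sub_neg_eq_add]; exact hJ'⟩]
  -- images of the two vertical generators
  have htt : t * t = 1 := by rcases ht with rfl | rfl <;> norm_num
  have hMf : M f₀ = barlowPos 1 (Real.sqrt (2 / 3)) (fun _ : ℤ => ε * t) t I' J' := by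
    have hdec : M f₀ = M g + (1 / 3 : ℝ) • (M u₀ + M v₀) := by
      rw [hg, map_sub, map_smul, map_add]; abel
    have hI'r : ((Ia : ℝ) + Ib - ε) = 3 * I' := by exact_mod_cast hI'
    have hJ'r : ((Ja : ℝ) + Jb - ε) = 3 * J' := by exact_mod_cast hJ'
    have httr : (t : ℝ) * t = 1 := by exact_mod_cast htt
    apply eq_of_apply_fin3
    · rw [hdec, PiLp.add_apply, PiLp.smul_apply, PiLp.add_apply, hMg0.1, ha, hb, a0, b0,
        barlowPos_apply_zero, haggLabel_constε, smul_eq_mul]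
      push_cast
      linear_combination (1 / 3 : ℝ) * hI'r + (1 / 6 : ℝ) * hJ'r - ((ε : ℝ) / 2) * httr
    · rw [hdec, PiLp.add_apply, PiLp.smul_apply, PiLp.add_apply, hMg0.2, ha, hb, a1, b1,
        barlowPos_apply_one, haggLabel_constε, smul_eq_mul]
      push_cast
      linear_combination (Real.sqrt 3 / 6) * hJ'r - (Real.sqrt 3 * ε / 6) * httr
    · rw [hdec, PiLp.add_apply, PiLp.smul_apply, PiLp.add_apply, hMgt, ha, hb,
        (barlowPos_inLayer_apply _ constHagg Ia Ja).2.2, (barlowPos_inLayer_apply _ constHagg Ib Jb).2.2,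
        barlowPos_apply_two, smul_eq_mul]
      ring
  have hMfneg : M (barlowPos 1 (Real.sqrt (2 / 3)) (fun _ : ℤ => (-1 : ℤ)) 1 0 0) =
      barlowPos 1 (Real.sqrt (2 / 3)) (fun _ : ℤ => -(ε * t)) t (-I') (-J') := by
    have hdec : M (barlowPos 1 (Real.sqrt (2 / 3)) (fun _ : ℤ => (-1 : ℤ)) 1 0 0) =
        M g - (1 / 3 : ℝ) • (M u₀ + M v₀) := by
      rw [hfneg, map_sub, map_smul, map_add]
    have hI'r : ((Ia : ℝ) + Ib - ε) = 3 * I' := by exact_mod_cast hI'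
    have hJ'r : ((Ja : ℝ) + Jb - ε) = 3 * J' := by exact_mod_cast hJ'
    have httr : (t : ℝ) * t = 1 := by exact_mod_cast htt
    apply eq_of_apply_fin3
    · rw [hdec, PiLp.sub_apply, PiLp.smul_apply, PiLp.add_apply, hMg0.1, ha, hb, a0, b0,
        barlowPos_apply_zero, haggLabel_constε, smul_eq_mul]
      push_cast
      linear_combination (-1 / 3 : ℝ) * hI'r - (1 / 6 : ℝ) * hJ'r + ((ε : ℝ) / 2) * httr
    · rw [hdec, PiLp.sub_apply, PiLp.smul_apply, PiLp.add_apply, hMg0.2, ha, hb, a1, b1,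
        barlowPos_apply_one, haggLabel_constε, smul_eq_mul]
      push_cast
      linear_combination (-Real.sqrt 3 / 6) * hJ'r + (Real.sqrt 3 * ε / 6) * httr
    · rw [hdec, PiLp.sub_apply, PiLp.smul_apply, PiLp.add_apply, hMgt, ha, hb,
        (barlowPos_inLayer_apply _ constHagg Ia Ja).2.2, (barlowPos_inLayer_apply _ constHagg Ib Jb).2.2,
        barlowPos_apply_two, smul_eq_mul]
      ring
  -- conclude by generator capture, twice
  have hc : ε * t = 1 ∨ ε * t = -1 := by
    rcases hε with rfl | rfl <;> rcases ht with rfl | rfl <;> norm_num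
  have hc' : -(ε * t) = 1 ∨ -(ε * t) = -1 := by rcases hc with h | h <;> rw [h] <;> norm_num
  refine ⟨ε * t, hc, ?_, ?_⟩
  · have e : fccStacking 1 (Real.sqrt (2 / 3)) = barlowStacking 1 (Real.sqrt (2 / 3)) (fun _ : ℤ => (1 : ℤ)) :=
      rfl
    rw [e]
    refine image_const_eq_of_generators (Or.inl rfl) hc M ?_ ?_ ?_
    · rw [barlowPos_inLayer_eq _ (fun _ : ℤ => (1 : ℤ)) constHagg, ← hu₀, ha,
        barlowPos_inLayer_eq _ constHagg (fun _ : ℤ => ε * t)]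
      exact ⟨_, _, _, rfl⟩
    · rw [barlowPos_inLayer_eq _ (fun _ : ℤ => (1 : ℤ)) constHagg, ← hv₀, hb,
        barlowPos_inLayer_eq _ constHagg (fun _ : ℤ => ε * t)]
      exact ⟨_, _, _, rfl⟩
    · have e1 : barlowPos 1 (Real.sqrt (2 / 3)) (fun _ : ℤ => (1 : ℤ)) 1 0 0 = f₀ := by rw [hf₀]; rfl
      rw [e1, hMf]
      exact ⟨_, _, _, rfl⟩
  · refine image_const_eq_of_generators (Or.inr rfl) hc' M ?_ ?_ ?_
    · rw [barlowPos_inLayer_eq _ (fun _ : ℤ => (-1 : ℤ)) constHagg, ← hu₀, ha,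
        barlowPos_inLayer_eq _ constHagg (fun _ : ℤ => -(ε * t))]
      exact ⟨_, _, _, rfl⟩
    · rw [barlowPos_inLayer_eq _ (fun _ : ℤ => (-1 : ℤ)) constHagg, ← hv₀, hb,
        barlowPos_inLayer_eq _ constHagg (fun _ : ℤ => -(ε * t))]
      exact ⟨_, _, _, rfl⟩
    · rw [hMfneg]; exact ⟨_, _, _, rfl⟩

end Summit.Ventures.Crystal3D.Theorems

end
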